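import Summits.Ventures.Crystal3D.Kissing125.SearchCheck3
import Summits.Ventures.Crystal3D.Kissing125.SearchDefs1
import Literature.Geometry.DiscreteGeometry.KissingSearchRoot
import HarnessLib

/-!
# Transport: K25 states read as tree states

HONEST FRAMING (cell pub-crystal3d, K-path at `h = 5/4`, V4 = κ as an explicit parameter): this is NOT a result printed
by Hales; it is his METHOD (arXiv:1209.6043, Theorem 3 + Lemmas 7–10, in the tree's form of a verified interval-arithmetic
growth search, `Literature/…/KissingSearch*.lean`) with the largest long-side cosine `κ` made an EXPLICIT PARAMETER
(`κ : Kappa`, carrying the two numeric facts the soundness proof uses: `-1/2 ≤ κ`, `κ < 1/4`).  Only the declarations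
whose statement depends on `κ` are declared here (namespace `…Kissing125.GSearch`, the tree's short names, no renames);
every κ-free helper is the landed K25 copy (`…Kissing125.KissingSearch.*`) and every κ-free lemma is cited from the tree
(PRIVATE per-file citation aliases; `GSearchTransport.lean` holds `toT : St → tree St` and the transport equalities).  The K25
instance is `κ25 = ⟨7/32, …⟩`; `GSearchBridge.lean` identifies the generic checker at
`κ25` with the landed `Kissing125.KissingSearch.checkPart`, so the landed run files are consumed unchanged.  Generated by
`HOME/lean/kissing125/v4-prep/gen/mkgen.py`; nothing here is asserted about GAP(1.26) or any census.

THIS FILE: `toT : St → tree St` (the landed K25 `St` and the tree's `St` have the same three arrays) and the transport equalities for the structurally recursive κ-free helpers (`foldRange`, `foldSyms`, `firstOk`, `lastOk`, `linkReach`) and the folds built on them (`hdeg2`, `cdeg`, `nlong`, `nused`, `nlongAt`, `linkSummary`, `widest`, `newLabel`, `mkRoot`); used by the private citation aliases of the generic files. It imports the tree's whole search stack (`KissingSearchRoot`) so that every downstream file can cite tree lemmas.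

## References
* T. C. Hales, *A proof of Fejes Tóth's conjecture on sphere packings with kissing number twelve*,
  arXiv:1209.6043 (2012): Definition 1, Theorem 2, Theorem 3, Lemmas 7–10. [`Hales2012`]
* R. E. Moore, *Interval Analysis* (1966), Theorem 3.1, §4.4. [`Moore1966`]
-/

namespace Summit.Ventures.Crystal3D.Kissing125

open Literature.Geometry.DiscreteGeometry
open Summit.Ventures.Crystal3D.Kissing125.KissingSearch

namespace GSearch

open Real Literature.Analysis.ValidatedNumerics KissingLP NonemptyInterval Finset


/-! ### Transport of the κ-free K25 copies to the tree's declarations -/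

/-- The K25 state read as a tree state (same three arrays). [folklore] -/
def toT (s : St) : Literature.Geometry.DiscreteGeometry.KissingSearch.St := ⟨s.tris, s.dom, s.sc⟩

/-- Transport: the K25 copy of `foldRange` is the tree's `foldRange` (both structurally recursive; by induction). [folklore] -/
theorem foldRange_tr {β : Type} (f : β → ℕ → β) (i n : ℕ) (acc : β) :
    foldRange f i n acc = Literature.Geometry.DiscreteGeometry.KissingSearch.foldRange f i n acc := by
  induction n generalizing i acc with
  | zero => rfl
  | succ n ih => simp only [foldRange, Literature.Geometry.DiscreteGeometry.KissingSearch.foldRange, ih]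

/-- Transport: the K25 copy of `foldSyms` is the tree's. [folklore] -/
theorem foldSyms_tr {β : Type} (f : β → ℕ → β) (r : ℕ) (acc : β) :
    foldSyms f r acc = Literature.Geometry.DiscreteGeometry.KissingSearch.foldSyms f r acc := by
  unfold foldSyms Literature.Geometry.DiscreteGeometry.KissingSearch.foldSyms; simp only [foldRange_tr]; rfl

/-- Transport: the K25 copy of `firstOk` is the tree's (by induction). [folklore] -/
theorem firstOk_tr (ok : ℕ → Bool) (lo n : ℕ) : firstOk ok lo n = Literature.Geometry.DiscreteGeometry.KissingSearch.firstOk ok lo n := by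
  induction n generalizing lo with
  | zero => rfl
  | succ n ih => simp only [firstOk, Literature.Geometry.DiscreteGeometry.KissingSearch.firstOk, ih]

/-- Transport: the K25 copy of `lastOk` is the tree's (by induction). [folklore] -/
theorem lastOk_tr (ok : ℕ → Bool) (hi n : ℕ) : lastOk ok hi n = Literature.Geometry.DiscreteGeometry.KissingSearch.lastOk ok hi n := by
  induction n generalizing hi with
  | zero => rfl
  | succ n ih => simp only [lastOk, Literature.Geometry.DiscreteGeometry.KissingSearch.lastOk, ih]

/-- Transport: `hdeg2` of a K25 state is `hdeg2` of the same state read as a tree state. [folklore] -/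
theorem hdeg2_tr (s : St) (v : ℕ) : s.hdeg2 v = (toT s).hdeg2 v := by
  unfold St.hdeg2 Literature.Geometry.DiscreteGeometry.KissingSearch.St.hdeg2; rw [foldRange_tr]; rfl

/-- Transport: `cdeg` of a K25 state is `cdeg` of the same state read as a tree state. [folklore] -/
theorem cdeg_tr (s : St) (v : ℕ) : s.cdeg v = (toT s).cdeg v := by
  unfold St.cdeg Literature.Geometry.DiscreteGeometry.KissingSearch.St.cdeg; rw [foldRange_tr]; rfl

/-- Transport: `nlong` of a K25 state is `nlong` of the same state read as a tree state. [folklore] -/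
theorem nlong_tr (s : St) : s.nlong = (toT s).nlong := by
  unfold St.nlong Literature.Geometry.DiscreteGeometry.KissingSearch.St.nlong; rw [foldRange_tr]; rfl

/-- Transport: `nused` of a K25 state is `nused` of the same state read as a tree state. [folklore] -/
theorem nused_tr (s : St) : s.nused = (toT s).nused := by
  unfold St.nused Literature.Geometry.DiscreteGeometry.KissingSearch.St.nused; rw [foldRange_tr]; simp only [hdeg2_tr]; try rfl

/-- Transport: `nlongAt` of a K25 state is `nlongAt` of the same state read as a tree state. [folklore] -/
theorem nlongAt_tr (s : St) (v : ℕ) : s.nlongAt v = (toT s).nlongAt v := by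
  unfold St.nlongAt Literature.Geometry.DiscreteGeometry.KissingSearch.St.nlongAt; rw [foldRange_tr]; rfl

/-- Transport: `linkSummary` of a K25 state is `linkSummary` of the same state read as a tree state. [folklore] -/
theorem linkSummary_tr (s : St) (v : ℕ) : s.linkSummary v = (toT s).linkSummary v := by
  unfold St.linkSummary Literature.Geometry.DiscreteGeometry.KissingSearch.St.linkSummary; rw [foldRange_tr]; rfl

/-- Transport: `widest` of a K25 state is `widest` of the same state read as a tree state. [folklore] -/
theorem widest_tr (s : St) : s.widest = (toT s).widest := by
  unfold St.widest Literature.Geometry.DiscreteGeometry.KissingSearch.St.widest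
  generalize (144 : ℕ) = n
  rw [foldRange_tr]
  rfl

/-- Transport: `newLabel` of a K25 state is `newLabel` of the same state read as a tree state. [folklore] -/
theorem newLabel_tr (s : St) : s.newLabel = (toT s).newLabel := by
  unfold St.newLabel Literature.Geometry.DiscreteGeometry.KissingSearch.St.newLabel; simp only [hdeg2_tr]; try rfl

/-- Transport: `linkReach` of a K25 state is `linkReach` of the same state read as a tree state (by induction on the fuel). [folklore] -/
theorem linkReach_tr (s : St) (v fuel : ℕ) (seen front : List ℕ) :
    s.linkReach v fuel seen front = (toT s).linkReach v fuel seen front := by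
  induction fuel generalizing seen front with
  | zero => rfl
  | succ n ih =>
    cases front with
    | nil => rfl
    | cons x front => simp only [St.linkReach, Literature.Geometry.DiscreteGeometry.KissingSearch.St.linkReach, ih]; rfl

/-- `toT` of an explicit state. [folklore] -/
@[simp] theorem toT_mk (t d c : Array ℕ) : toT ⟨t, d, c⟩ = ⟨t, d, c⟩ := rfl
/-- `toT` keeps the placed triangles. [folklore] -/
@[simp] theorem toT_tris (s : St) : (toT s).tris = s.tris := rfl
/-- `toT` keeps the domains. [folklore] -/
@[simp] theorem toT_dom (s : St) : (toT s).dom = s.dom := rfl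
/-- `toT` keeps the side counts. [folklore] -/
@[simp] theorem toT_sc (s : St) : (toT s).sc = s.sc := rfl
/-- `toT` commutes with `gsc`. [folklore] -/
@[simp] theorem toT_gsc (s : St) (a b : ℕ) : (toT s).gsc a b = s.gsc a b := rfl
/-- `toT` commutes with `gdom`. [folklore] -/
@[simp] theorem toT_gdom (s : St) (a b : ℕ) : (toT s).gdom a b = s.gdom a b := rfl

/-- `toT` commutes with `sdom`. [folklore] -/
@[simp] theorem sdom_tr (s : St) (a b r : ℕ) : toT (s.sdom a b r) = (toT s).sdom a b r := rfl

/-- Transport: the K25 root state read as a tree state is the tree's root state. [folklore] -/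
theorem mkRoot_tr (m bits : ℕ) : toT (mkRoot m bits) = Literature.Geometry.DiscreteGeometry.KissingSearch.mkRoot m bits := by
  unfold mkRoot Literature.Geometry.DiscreteGeometry.KissingSearch.mkRoot; simp only [sdom_tr, toT_mk]; rfl

end GSearch

end Summit.Ventures.Crystal3D.Kissing125
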